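import Mathlib
import Summits.NavierStokesRegularity.NavierStokesRegularity.Theorems.TaoLadderRungTwoFlatNearBehindStep
import HarnessLib

/-!
# The NEAR and BEHIND per-hop obligations of the R54 tube at the choice rule — composition OF RECORD (core input `r_c` as a
  hypothesis) with the budgets at an anchor-scale lower bound `a_lo ≤ clampedRatio` (theory-1 g47 P-59a option 2 / P-60a)
  (helper for the K_A♭ parent item stmt-NavierStokesRegularity-22987 `FlatGapCertificatesV2`, child 2A `GradedAdiabaticWakeA` of
  route TaoLadderRungTwoFlat; cell harvest/h2-tao-ladder, p1 g23; LADDER §59–§60)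

`…NearBehindStep.tubeStepNearBehindR54_of_schedule` (of record, core bottom input `hcoreIn` as hypothesis) checks the two budgets at
the format floor `((1+ε₀)^{−θ₀})²` at every hop (TRAP #18); `…NearBehindStepAlo` repairs this but sits on the three-zone Grönwall loop,
whose scalar hypotheses are infeasible for every tube state (theory-1 g47 NUM-T60 TRAP #19: the exponent `2‖α̃‖₁M̃Λ` with
`M̃ ≥ A_*`). This module is the repair on the composition of record: `hcoreIn` stays a hypothesis (to be discharged by a
linearised/Duhamel core estimate, L-56d/L-60e), the budgets are checked at a schedule ratio `a_lo` with `a_lo ≤ clampedRatio` at good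
times as a hypothesis (`halo`, a core/anchor output; the floor version is the instance `a_lo := (1+ε₀)^{−θ₀}`).

* `tubeStepNearBehindR54_of_schedule_halo`.

HONEST FRAMING: bookkeeping over the cell's typed induction frame and p1's zone lemmas (MODEL lattice, graded mirror table on
`S♭`, `m = 2`); every remaining input is a HYPOTHESIS; nothing certified; no item closed; nothing about the Navier–Stokes equations.
-/

noncomputable section

-- the sub-problem namespace repeats the summit name by design (D-0017)
set_option linter.dupNamespace false

namespace Summit.NavierStokesRegularity.NavierStokesRegularity.Theorems.HopTube

open Set Finset Literature.Analysis.FluidPDE Literature.Analysis.FluidPDE.TaoCascade MirrorPulse GappedFrontRobustOn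

section Step

variable {ε ε₀ : ℝ}

/-- **`TubeStepNear` ∧ `TubeStepBehind` OF THE R54 TUBE AT THE CHOICE RULE, core input as HYPOTHESIS (`hcoreIn`, the composition
of record) and budgets at an anchor-scale lower bound `a_lo ≤ clampedRatio` (hypothesis `halo`)** — theory-1 g47 P-59a option 2 /
P-60a: the TRAP #18 cure WITHOUT the three-zone Grönwall loop (TRAP #19). See the module docstring.
[cite: Tao2016AveragedNS, §4 (4.1), (4.3), (4.5), (4.8), §6.3–6.4 Props. 6.4–6.5 (statement shape of the inductive step); route TaoLadderRungTwoFlat, `HopTube.TubeStepNearWith`/`TubeStepBehindWith` for `behindR54` (cell LADDER §50, §54–§58)] -/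
theorem tubeStepNearBehindR54_of_schedule_halo (P : TubeSchedule) {θ' : ℝ} {Wb : ℕ → ℝ} {i₀ : Fin 2}
    {X₀ : Fin 2 → ℝ} {w : ℤ → ℝ} {r θ₀ c₀ t₀ : ℝ} {ζ : ℕ → Fin 2 → ℤ → ℝ} {ustar : Fin 2 → ℤ → ℝ}
    {good : ℕ → (Fin 2 → ℤ → ℝ → ℝ) → ℝ → Prop} {n : ℕ}
    {cW κ₂ : ℝ} {W₀ FW₀ BW₀ : Fin 2 → ℤ → ℝ} {W FW : Fin 2 → ℤ → ℝ → ℝ}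
    (hWflow : PseudoFlowOnShift shiftSetFlat cW ε₀ (mirrorTable ε ε) 0 κ₂ W₀ FW₀ BW₀ W FW) (hcW : c₀ ≤ cW)
    (hε : 0 ≤ ε) (hε₀ : 0 < ε₀) (hn : P.N₀ < n) (hDK : P.K + 1 ≤ P.D) (hθV : 0 ≤ P.θV)
    (hθ : 0 < θ') (hθ5 : θ' ≤ 5 * Real.log (1 + ε₀)) (hw1 : ∀ k, 1 ≤ w k) (hr0 : 0 ≤ r)
    (hAstar : 0 < P.Astar) {ωK MuK : ℝ} (hωK : 0 < ωK)
    (hωKle : ∀ i, ωK ≤ MirrorPulse.geomGauge P.g P.b i (-(P.K : ℤ))) (hMuK : ∀ i, |ustar i (-(P.K : ℤ))| ≤ MuK)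
    (hWbn : 0 ≤ Wb n) (hWbn1 : 0 ≤ Wb (n + 1)) (hvn1 : 0 ≤ P.v (n + 1))
    {tlo : ℝ} (htlo : 0 < tlo)
    (hex : ∀ z S₀ τ S F, HopPremiseWith P (behindR54 P θ' Wb) shiftSetFlat ε₀ i₀ (mirrorTable ε ε) X₀ w r c₀ ζ
      ustar n z S₀ τ S F → ∃ t, good n S t)
    (hwin : ∀ z S₀ τ S F, HopPremiseWith P (behindR54 P θ' Wb) shiftSetFlat ε₀ i₀ (mirrorTable ε ε) X₀ w r c₀ ζ
      ustar n z S₀ τ S F → ∀ t, good n S t → tlo ≤ t ∧ t ≤ c₀)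
    {alo : ℝ} (halo0 : 0 ≤ alo)
    (halo : ∀ z S₀ τ S F, HopPremiseWith P (behindR54 P θ' Wb) shiftSetFlat ε₀ i₀ (mirrorTable ε ε) X₀ w r c₀ ζ
      ustar n z S₀ τ S F → ∀ t, good n S t → alo ≤ clampedRatio P i₀ ε₀ θ₀ t S)
    {Aeff A A₀ A₁ M M₁ rc μN μB VbarN VbarB EW RT V₀N V₀B EN : ℝ} (hAeff : 0 < Aeff) (hM0 : 0 ≤ M)
    (hM : ∀ s ∈ Icc 0 c₀, ∀ i, ∀ m ∈ Finset.Icc (-(P.D : ℤ)) (1 - (P.K : ℤ)), |W i m s| ≤ M)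
    (hM₁ : ∀ s ∈ Icc 0 c₀, |W 1 (-(P.K : ℤ)) s| ≤ M₁)
    (hEW : ∀ z, InTubeWith P (behindR54 P θ' Wb) i₀ X₀ w r ζ ustar n z →
      coMovingEnergyOn (Finset.Icc (1 - (P.D : ℤ)) (-(P.K : ℤ))) P.θV (-(P.K : ℝ))
        (fun i k _ => anchorScale P i₀ z * ustar i k - W₀ i k) 0 ≤ EW)
    (hcoreIn : ∀ z S₀ τ S F, HopPremiseWith P (behindR54 P θ' Wb) shiftSetFlat ε₀ i₀ (mirrorTable ε ε) X₀ w r c₀ ζ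
      ustar n z S₀ τ S F → ∀ t, good n S t → ∀ s ∈ Icc 0 t, ∀ i, |(S - W) i (1 - (P.K : ℤ)) s| ≤ rc)
    (hrc0 : 0 ≤ rc)
    (hRT : ∀ z S₀ τ S F, HopPremiseWith P (behindR54 P θ' Wb) shiftSetFlat ε₀ i₀ (mirrorTable ε ε) X₀ w r c₀ ζ
      ustar n z S₀ τ S F → ∀ t, good n S t →
        ∑ k ∈ Finset.Icc (-(P.D : ℤ)) (-(P.K : ℤ) - 1), Real.exp (P.θV * ((k : ℝ) + P.K)) *
          ∑ i : Fin 2, (W i (1 + k) t - |S i₀ 1 t| / P.Astar * ustar i k) ^ 2 / 2 ≤ RT)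
    (hAdef : A = Real.sqrt (2 * VbarB) * Real.exp (θ' / 2) * Real.exp (θ' * ((P.D : ℝ) - P.K) / 2) + M)
    (hA₀def : A₀ = M + rc) (hA₁def : A₁ = M₁ + Real.sqrt (2 * VbarN) * Real.exp (P.θV / 2))
    (hrA : rc ≤ A) (hA₀le : A₀ ≤ Aeff)
    (hV₀Ndef : V₀N = (Real.sqrt (P.v n + (P.δ n / ωK) ^ 2) + Real.sqrt P.D * r + Real.sqrt EW) ^ 2)
    (hV₀Bdef : V₀B = (Real.sqrt (Wb n + (MuK + P.δ n / ωK) ^ 2) + r / Real.sqrt (1 - Real.exp (-θ'))) ^ 2)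
    (hENdef : EN = Real.exp (P.θV * ((1 : ℝ) - P.D + P.K)) * ((1 + ε) * 1 * A ^ 2 * (A + M))
      + (1 + ε) * 1 * rc * (A ^ 2 + M * rc))
    (hμN : 0 < μN)
    (hμNle : μN ≤ (1 / c₀) * P.θV - 2 * (1 + ε) * 1 * (A * Real.sinh (P.θV / 2) + M * (3 + Real.exp P.θV)))
    (hμB : 0 < μB) (hμBle : μB ≤ (1 / c₀) * θ' - 2 * (1 + ε) * Aeff * Real.sinh (θ' / 2))
    (hlevN : V₀N + EN * c₀ < VbarN) (hlevB : V₀B + A₁ * A₀ * (A₁ + ε * A₀) * c₀ < VbarB)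
    (hclose : Real.sqrt (2 * VbarB) * Real.exp (θ' / 2) ≤ Aeff)
    (hbudgetN : ∀ t ∈ Icc tlo c₀, (Real.sqrt (Real.exp (-μN * t) * V₀N + EN * (1 - Real.exp (-μN * t)) / μN)
      + Real.sqrt RT) ^ 2 ≤ alo ^ 2 * P.v (n + 1))
    (hbudgetB : ∀ t ∈ Icc tlo c₀, Real.exp (-μB * t) * V₀B + A₁ * A₀ * (A₁ + ε * A₀) * (1 - Real.exp (-μB * t)) / μB
      ≤ alo ^ 2 * Wb (n + 1)) :
    TubeStepNearWith P (behindR54 P θ' Wb) (choiceRule P i₀ ε₀ θ₀ t₀ good) shiftSetFlat ε₀ i₀ (mirrorTable ε ε)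
        X₀ w r c₀ ζ ustar n ∧
      TubeStepBehindWith P (behindR54 P θ' Wb) (choiceRule P i₀ ε₀ θ₀ t₀ good) shiftSetFlat ε₀ i₀ (mirrorTable ε ε)
        X₀ w r c₀ ζ ustar n := by
  have hε₀' : (-1 : ℝ) < ε₀ := by linarith
  have hEN0 : 0 ≤ EN := by
    have hA0 : 0 ≤ A := hrc0.trans hrA
    rw [hENdef]; positivity
  -- the two landing clauses at every good time of every premise
  have key : ∀ z S₀ τ S F, HopPremiseWith P (behindR54 P θ' Wb) shiftSetFlat ε₀ i₀ (mirrorTable ε ε) X₀ w r c₀ ζ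
      ustar n z S₀ τ S F → ∀ t, good n S t →
        NearClause P i₀ ustar (n + 1) (recentre S t (clampedRatio P i₀ ε₀ θ₀ t S)) ∧
        R54.BehindEnergyClause P.K θ' (Wb (n + 1)) (recentre S t (clampedRatio P i₀ ε₀ θ₀ t S)) := by
    intro z S₀ τf S F hprem t hgood
    obtain ⟨htlo_t, htc₀⟩ := hwin z S₀ τf S F hprem t hgood
    have htpos : 0 < t := htlo.trans_le htlo_t
    have hcore_t := hcoreIn z S₀ τf S F hprem t hgood
    have hRT_t := hRT z S₀ τf S F hprem t hgood
    have halo_t := halo z S₀ τf S F hprem t hgood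
    obtain ⟨hz, hkick, hc₀τ, hflow⟩ := hprem
    -- the clauses of `H(n)` (tube phase)
    have hzW : InTubeWith P (behindR54 P θ' Wb) i₀ X₀ w r ζ ustar n z := hz
    have h0 : n ≠ 0 := by omega
    have h1 : ¬ n ≤ P.N₀ := by omega
    simp only [InTubeWith, h0, if_false, h1] at hz
    obtain ⟨hanch, hcoreCl, hnearCl, hbeh, -⟩ := hz
    -- restrict both flows to `[0, t]`
    have hS' := pseudoFlowOnShift_mono hflow htpos (htc₀.trans hc₀τ)
    have hW' := pseudoFlowOnShift_mono hWflow htpos (htc₀.trans hcW)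
    -- the kick, everywhere (weights `≥ 1`)
    have hkick' : ∀ i k, |S₀ i k - z i k| ≤ r := by
      intro i k
      calc |S₀ i k - z i k| = 1 * |S₀ i k - z i k| := (one_mul _).symm
        _ ≤ w k * |S₀ i k - z i k| := mul_le_mul_of_nonneg_right (hw1 k) (abs_nonneg _)
        _ ≤ r := hkick i k
    -- the ratio of the choice rule
    have ha : 0 < clampedRatio P i₀ ε₀ θ₀ t S := clampedRatio_pos P i₀ hε₀' θ₀ t S
    have hfa2 : alo ^ 2 ≤ clampedRatio P i₀ ε₀ θ₀ t S ^ 2 := pow_le_pow_left₀ halo0 halo_t 2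
    -- the STARTS from `H(n)`
    have hstartN : coMovingEnergyOn (Finset.Icc (1 - (P.D : ℤ)) (-(P.K : ℤ))) P.θV (-(P.K : ℝ)) (S - W) 0 ≤ V₀N := by
      have h := sqrt_initial_coMovingEnergyOn_le_additive P hflow.init_S hWflow.init_S hθV hDK hnearCl hcoreCl hωK hωKle
        (fun i k _ => hkick' i k) hr0 (hEW z hzW)
      have hnn : 0 ≤ coMovingEnergyOn (Finset.Icc (1 - (P.D : ℤ)) (-(P.K : ℤ))) P.θV (-(P.K : ℝ)) (S - W) 0 :=
        coMovingEnergyOn_nonneg _ _ _ _ _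
      rw [hV₀Ndef]
      calc coMovingEnergyOn (Finset.Icc (1 - (P.D : ℤ)) (-(P.K : ℤ))) P.θV (-(P.K : ℝ)) (S - W) 0
          = Real.sqrt (coMovingEnergyOn (Finset.Icc (1 - (P.D : ℤ)) (-(P.K : ℤ))) P.θV (-(P.K : ℝ)) (S - W) 0) ^ 2 :=
            (Real.sq_sqrt hnn).symm
        _ ≤ _ := pow_le_pow_left₀ (Real.sqrt_nonneg _) h 2
    have haK : ∀ i, |z i (-(P.K : ℤ))| ≤ MuK + P.δ n / ωK := fun i =>
      abs_windowBottom_le_of_clauses P hAstar hanch hcoreCl hωK hωKle hMuK i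
    have hstartB : ∀ L : ℕ, coMovingEnergyOn (Finset.Icc (1 - (P.K : ℤ) - L) (-(P.K : ℤ))) θ' (-(P.K : ℝ)) S 0
        ≤ V₀B := by
      intro L
      rw [hV₀Bdef]
      exact R54.initial_blockEnergy_le_additive hflow.init_S hθ hbeh.1 hWbn haK
        (fun i k hk => hkick' i k) hr0
    -- rates and levels at this `t ≤ c₀`
    have h1t : 1 / c₀ ≤ 1 / t := one_div_le_one_div_of_le htpos htc₀
    have hμNle' : μN ≤ (1 / t) * P.θV - 2 * (1 + ε) * 1 * (A * Real.sinh (P.θV / 2) + M * (3 + Real.exp P.θV)) := by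
      have h2 := mul_le_mul_of_nonneg_right h1t hθV
      linarith only [h2, hμNle]
    have hμBle' : μB ≤ (1 / t) * θ' - 2 * (1 + ε) * Aeff * Real.sinh (θ' / 2) := by
      have h2 := mul_le_mul_of_nonneg_right h1t hθ.le
      linarith only [h2, hμBle]
    have hlevN' : V₀N + EN * t < VbarN := by
      have h2 := mul_le_mul_of_nonneg_left htc₀ hEN0
      linarith only [h2, hlevN]
    have hA₁0 : 0 ≤ A₁ := by
      rw [hA₁def]
      have hM₁0 : 0 ≤ M₁ := (abs_nonneg _).trans (hM₁ 0 ⟨le_rfl, htpos.le.trans htc₀⟩)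
      exact add_nonneg hM₁0 (mul_nonneg (Real.sqrt_nonneg _) (Real.exp_pos _).le)
    have hA₀0 : 0 ≤ A₀ := by rw [hA₀def]; exact add_nonneg hM0 hrc0
    have hEtop0 : 0 ≤ A₁ * A₀ * (A₁ + ε * A₀) :=
      mul_nonneg (mul_nonneg hA₁0 hA₀0) (add_nonneg hA₁0 (mul_nonneg hε hA₀0))
    have hlevB' : V₀B + A₁ * A₀ * (A₁ + ε * A₀) * t < VbarB := by
      have h2 := mul_le_mul_of_nonneg_left htc₀ hEtop0
      linarith only [h2, hlevB]
    have hστ : (1 / t) * t = 1 := by rw [one_div, inv_mul_cancel₀ (ne_of_gt htpos)]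
    -- budgets at the clamped ratio
    have hbN := hbudgetN t ⟨htlo_t, htc₀⟩
    have hbB := hbudgetB t ⟨htlo_t, htc₀⟩
    have hbN' : (Real.sqrt (Real.exp (-μN * t) * V₀N + EN * (1 - Real.exp (-μN * t)) / μN) + Real.sqrt RT) ^ 2
        ≤ clampedRatio P i₀ ε₀ θ₀ t S ^ 2 * P.v (n + 1) :=
      hbN.trans (mul_le_mul_of_nonneg_right hfa2 hvn1)
    have hbB' : Real.exp (-μB * t) * V₀B + A₁ * A₀ * (A₁ + ε * A₀) * (1 - Real.exp (-μB * t)) / μB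
        ≤ clampedRatio P i₀ ε₀ θ₀ t S ^ 2 * Wb (n + 1) :=
      hbB.trans (mul_le_mul_of_nonneg_right hfa2 hWbn1)
    -- the joint hop
    rw [hENdef] at hbN' hlevN'
    exact R54.near_behind_hop_of_schedule_sharp P hW' hS' hε hε₀ hDK hθV hθ.le hθ5 hAeff htpos le_rfl hστ ha hM0
      (fun s hs => hM s ⟨hs.1, hs.2.trans htc₀⟩) (fun s hs => hM₁ s ⟨hs.1, hs.2.trans htc₀⟩) hcore_t hrc0
      hAdef hA₀def hA₁def hrA hA₀le hstartN hstartB hμN hμNle' hμB hμBle' hlevN' hlevB' hclose hRT_t hbN' hbB'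
  have hwin' : ∀ z S₀ τ S F, HopPremiseWith P (behindR54 P θ' Wb) shiftSetFlat ε₀ i₀ (mirrorTable ε ε) X₀ w r c₀ ζ
      ustar n z S₀ τ S F → ∀ t, good n S t → 0 < t ∧ t ≤ c₀ := fun z S₀ τ S F h t ht =>
    ⟨htlo.trans_le (hwin z S₀ τ S F h t ht).1, (hwin z S₀ τ S F h t ht).2⟩
  exact ⟨tubeStepNearWith_of_good hex fun z S₀ τ S F h t ht => (key z S₀ τ S F h t ht).1,
    tubeStepBehindR54_of_good hε₀' hex hwin' fun z S₀ τ S F h t ht => (key z S₀ τ S F h t ht).2⟩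

end Step

end Summit.NavierStokesRegularity.NavierStokesRegularity.Theorems.HopTube

end
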